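import Literature.NumberTheory.GelbartRogawski1991.LocalUnitaryRationalSimilitudeTransport
import Literature.NumberTheory.GelbartRogawski1991.LocalCongrCoinvariants
import HarnessLib

/-!
# The `χ`-coinvariants of the CM Weil representation under a rational similitude: `Θ_ξ(scaleT_{m₀} s′_χ) ≅ Θ_ξ(s_χ) ∘ Ad(k)`

Topic `NumberTheory/GelbartRogawski1991`; namespace `Literature.NumberTheory.GelbartRogawski1991.UnitaryDualPair.LocalSplitting`.  KERNEL ONLY: theorems; no definition,
no named fact, no `sorry`.  Cell `hodgecm-mathlib` (D-0151), programme P5 (crux HLiu418 = stmt-HodgeConjecture-24832), piece **(C3)-rep** of the road card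
`F0/P5/A-p18/g23/ROAD-L4if-v3.A-p18g23.md` §6 (A-p18 (g23), 2026-08-31): the COINVARIANT (theta-type) level of ★ P3u `toRep_localSplittingCMWith_localCongr_k`.

For the Weil representations `ω₁ = ω ∘ s_χ^{T₀}` and `ω₂ = ω ∘ scaleTransportSection_{m₀}(s_χ^{T₀′})` of `U(T₀)(L⁺_v)` on `𝒮(L⁺_vⁿ)` (★ P3u: `ω₁(k g k⁻¹) = L_k ω₂(g) L_k⁻¹`), the
centre `Z = U(J₁)(L⁺_v) ↪ U(T₀)(L⁺_v)` (★ `localCenter`, FIXED pointwise by `Ad(k)`, ★ L4-Ad `localCongr_localCenter`) and ANY character `ξ` of `Z`: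
* `commute_comp_localCenter'` — the centre commutes with everything (★ `localCenter_comm`), so the coinvariant representations `rep ξ ωᵢ` exist;
* **`exists_coinv_equiv_localCongr_k`** — the Levi operator `L_k` descends (★ `TwistedCoinv.mapEquiv`, `mapEquiv_rep`) to an ISOMORPHISM
  `e : (ω₂)_{Z,ξ} ≃ (ω₁)_{Z,ξ}` with `e ∘ rep ξ ω₂ (g) = rep ξ ω₁ (k g k⁻¹) ∘ e` — in the road's words **`Θ_ξ(λ, line m₀·a) ≅ Θ_ξ(λ, a) ∘ Ad(k)`**
  ([Liu2021, App. D §D.1 Step 3]: the theta-type representation is the maximal quotient on which the centre acts by `ξ`).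
Nothing of the cited sources is asserted; HC_CM is proved only modulo the printed citations until rung 0 closes.

## References
* [MoeglinVignerasWaldspurger1987] LNM 1291 (1987), Chap. 2 II.2, II.6; Chap. 3 IV.
* [Liu2021] Y. Liu, App. D §D.1 Step 3 (l. 5221).
* [GelbartRogawski1991] S. Gelbart, J. Rogawski, Invent. Math. 105 (1991), §3.1 Remark p. 457 L4–13.
-/

set_option autoImplicit false
set_option Elab.async false

noncomputable section

open scoped Matrix
open NumberField IsDedekindDomain MeasureTheory Matrix
open Literature.RepresentationTheory.HeisenbergGroup Literature.RepresentationTheory.HeisenbergGroup.SymplecticMatrix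
open Literature.NumberTheory.Automorphic Literature.NumberTheory.Automorphic.UnitaryGroup Literature.NumberTheory.Weil1964
open Literature.NumberTheory.GaloisRepresentations Literature.RepresentationTheory.HarrisKudlaSweet1996
open Literature.RepresentationTheory.TwistedCoinv

namespace Literature.NumberTheory.GelbartRogawski1991.UnitaryDualPair.LocalSplitting

/-! ## §1 The centre commutes -/

/-- a linear automorphism of `F_v^N` is continuous. [folklore] -/
private theorem continuous_linearEquiv' (F : Type) [Field F] [NumberField F] (v : HeightOneSpectrum (𝓞 F)) {N : ℕ}
    (a : (Fin N → v.adicCompletion F) ≃ₗ[v.adicCompletion F] (Fin N → v.adicCompletion F)) : Continuous a :=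
  (a : (Fin N → v.adicCompletion F) →ₗ[v.adicCompletion F] (Fin N → v.adicCompletion F)).continuous_on_pi

section Commute

variable {F : Type} {E : Type} [Field F] [NumberField F] [Field E] [NumberField E] [Algebra F E]
  {c : E ≃ₐ[F] E} {N : ℕ} {J : Matrix (Fin N) (Fin N) E} {J₁ : Matrix (Fin 1) (Fin 1) E} (hJ₁ : J₁ 0 0 ≠ 0) {v : HeightOneSpectrum (𝓞 F)}
  {S : Type*} [AddCommGroup S] [Module ℂ S]

/-- a representation of `U(J)(F_v)` commutes with its restriction to the centre. [cite: MoeglinVignerasWaldspurger1987, Chap. 2 II.2] -/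
theorem commute_comp_localCenter' (ω : Representation ℂ (localPi E c N J v) S) (g : localPi E c N J v) (u : localPi E c 1 J₁ v) :
    Commute (ω g) ((ω.comp (localCenter E c N J J₁ hJ₁ v)) u) := by
  rw [MonoidHom.comp_apply]
  exact Commute.map (localCenter_comm E c N J J₁ hJ₁ v u g) ω

end Commute


/-! ## §1b Generic: an intertwiner along a centre-fixing map of the group descends to the coinvariants -/

section Generic

variable {k : Type*} [CommRing k] {G H S : Type*} [Group G] [Group H] [AddCommGroup S] [Module k S]

/-- **Transport of `χ`-coinvariants along a conjugation.**  Two representations `ρ₁, ρ₂` of `G` on `S`, a homomorphism `ι : H →* G` (the centre), a map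
`κ : G → G` fixing `ι` pointwise, and a linear automorphism `T` with `ρ₁(κ g) ∘ T = T ∘ ρ₂(g)`: then `T` descends to `(ρ₂)_{H,χ} ≃ (ρ₁)_{H,χ}` intertwining
`rep χ ρ₂ (g)` with `rep χ ρ₁ (κ g)` (★ `mapEquiv` with the trivial multiplier). [cite: GelbartRogawski1991, §3.1 Remark p. 457 L4–13]
[cite: MoeglinVignerasWaldspurger1987, Chap. 2 II.2] -/
theorem _root_.Literature.RepresentationTheory.TwistedCoinv.exists_equiv_of_conj (ρ₁ ρ₂ : Representation k G S) (ι : H →* G) (κ : G → G)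
    (hκ : ∀ h, κ (ι h) = ι h) (T : S ≃ₗ[k] S) (hT : ∀ (g : G) (v : S), ρ₁ (κ g) (T v) = T (ρ₂ g v)) (χ : H →* kˣ)
    (hc₁ : ∀ (g : G) (h : H), Commute (ρ₁ g) ((ρ₁.comp ι) h)) (hc₂ : ∀ (g : G) (h : H), Commute (ρ₂ g) ((ρ₂.comp ι) h)) :
    ∃ e : Coinv (ρ₂.comp ι) χ ≃ₗ[k] Coinv (ρ₁.comp ι) χ, ∀ (g : G) (x : Coinv (ρ₂.comp ι) χ), e (rep χ ρ₂ hc₂ g x) = rep χ ρ₁ hc₁ (κ g) (e x) := by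
  have hTc : ∀ (h : H) (v : S), (ρ₁.comp ι) h (T v) = (((fun _ => (1 : kˣ)) h : kˣ) : k) • T ((ρ₂.comp ι) h v) := by
    intro h v
    have h1 := hT (ι h) v
    rw [hκ] at h1
    rw [MonoidHom.comp_apply, MonoidHom.comp_apply, Units.val_one, one_smul, h1]
  refine ⟨mapEquiv (ρ₂.comp ι) χ (ρ₁.comp ι) χ T (fun _ => 1) hTc (fun h => (one_mul _).symm), fun g x => ?_⟩
  obtain ⟨w, rfl⟩ := mk_surjective _ _ x
  rw [rep_mk, mapEquiv_mk, mapEquiv_mk, rep_mk, hT]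

end Generic

/-! ## §2 The coinvariants under `Ad(k)` -/

section CM

variable (L : Type) [Field L] [NumberField L] [IsCMField L] (v : HeightOneSpectrum (𝓞 (maximalRealSubfield L)))
  [MeasurableSpace (v.adicCompletion (maximalRealSubfield L))] [BorelSpace (v.adicCompletion (maximalRealSubfield L))]
  (μ : Measure (v.adicCompletion (maximalRealSubfield L))) [μ.IsAddHaarMeasure]
  (n : ℕ) {T₀ T₀' : Matrix (Fin n) (Fin n) (maximalRealSubfield L)} {J₀ J₀' : Matrix (Fin n) (Fin n) L} {J₁ : Matrix (Fin 1) (Fin 1) L} (hJ₁ : J₁ 0 0 ≠ 0)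

set_option synthInstance.maxHeartbeats 400000 in
set_option maxHeartbeats 4000000 in
/-- **`Θ_ξ(scaleT_{m₀} s_χ^{T₀′}) ≅ Θ_ξ(s_χ^{T₀}) ∘ Ad(k)`**: the Levi operator `L_k` of ★ P3u descends to an isomorphism of the `ξ`-coinvariants under the centre,
intertwining `rep ξ ω₂ (g)` with `rep ξ ω₁ (k g k⁻¹)`. [cite: Liu2021, App. D §D.1 Step 3 (l. 5221)] [cite: MoeglinVignerasWaldspurger1987, Chap. 2 II.2, II.6]
[cite: GelbartRogawski1991, §3.1 Remark p. 457 L4–13] -/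
theorem exists_coinv_equiv_localCongr_k (hn : 0 < n)
    (t : Fin n → maximalRealSubfield L) (hT₀t : T₀ = Matrix.diagonal t) (hT₀ : T₀.IsSymm) (hT₀d : IsUnit T₀.det)
    (hT₀' : T₀'.IsSymm) (hT₀'d : IsUnit T₀'.det) (m₀ : (maximalRealSubfield L)ˣ) (hTT₀ : T₀' = (m₀ : maximalRealSubfield L) • T₀)
    (hJ₀ : J₀ = T₀.map (algebraMap (maximalRealSubfield L) L)) (hJ₀' : J₀' = T₀'.map (algebraMap (maximalRealSubfield L) L))
    (k₀ : GL (Fin n) (maximalRealSubfield L))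
    (hk₀ : ((k₀ : Matrix (Fin n) (Fin n) (maximalRealSubfield L)))ᵀ * T₀ * (k₀ : Matrix (Fin n) (Fin n) (maximalRealSubfield L)) =
      (m₀ : maximalRealSubfield L) • T₀)
    {k : GL (Fin n) L} (hk : k = Matrix.GeneralLinearGroup.map (algebraMap (maximalRealSubfield L) L) k₀)
    (hkJ : formCongr ((IsCMField.complexConj L : L ≃ₐ[maximalRealSubfield L] L) : L →+* L) k
      (((algebraMap (maximalRealSubfield L) L) (m₀ : maximalRealSubfield L))⁻¹ • J₀) = J₀)
    (χ : HeckeCharacter L) (hχ : IsSplittingChar L 1 χ)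
    (m : LocalMp (maximalRealSubfield L) (n + n) (gramD (maximalRealSubfield L) n T₀) v)
    (hm : (deltaLagrangian (maximalRealSubfield L) v n).map (toLin (maximalRealSubfield L) v (MpPsi.proj _ m)) =
      lagrangianY (maximalRealSubfield L) (n + n) v)
    (ξ : UnitaryGroup.localPi L (IsCMField.complexConj L) 1 J₁ v →* ℂˣ) :
    ∃ e : Coinv (((MpPsi.toRep (localSchrodinger (maximalRealSubfield L) n T₀ v)).comp
            (scaleTransportSection (maximalRealSubfield L) L (IsCMField.complexConj L) n (complexConj_imagUnit L) (imagUnit_ne_zero L)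
              (imagUnit_mul_self L) T₀ T₀' hT₀ hT₀' m₀ hTT₀ hJ₀ hJ₀' v (localSplittingCMWith L n hT₀' hT₀'d hJ₀' χ hχ v μ)
              (proj_localSplittingCMWith L n hT₀' hT₀'d hJ₀' χ hχ v μ))).comp (localCenter L (IsCMField.complexConj L) n J₀ J₁ hJ₁ v)) ξ ≃ₗ[ℂ] Coinv (((MpPsi.toRep (localSchrodinger (maximalRealSubfield L) n T₀ v)).comp (localSplittingCMWith L n hT₀ hT₀d hJ₀ χ hχ v μ)).comp (localCenter L (IsCMField.complexConj L) n J₀ J₁ hJ₁ v)) ξ,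
      ∀ (g : UnitaryGroup.localPi L (IsCMField.complexConj L) n J₀ v) (x : Coinv (((MpPsi.toRep (localSchrodinger (maximalRealSubfield L) n T₀ v)).comp
            (scaleTransportSection (maximalRealSubfield L) L (IsCMField.complexConj L) n (complexConj_imagUnit L) (imagUnit_ne_zero L)
              (imagUnit_mul_self L) T₀ T₀' hT₀ hT₀' m₀ hTT₀ hJ₀ hJ₀' v (localSplittingCMWith L n hT₀' hT₀'d hJ₀' χ hχ v μ)
              (proj_localSplittingCMWith L n hT₀' hT₀'d hJ₀' χ hχ v μ))).comp (localCenter L (IsCMField.complexConj L) n J₀ J₁ hJ₁ v)) ξ),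
        e (rep ξ ((MpPsi.toRep (localSchrodinger (maximalRealSubfield L) n T₀ v)).comp
            (scaleTransportSection (maximalRealSubfield L) L (IsCMField.complexConj L) n (complexConj_imagUnit L) (imagUnit_ne_zero L)
              (imagUnit_mul_self L) T₀ T₀' hT₀ hT₀' m₀ hTT₀ hJ₀ hJ₀' v (localSplittingCMWith L n hT₀' hT₀'d hJ₀' χ hχ v μ)
              (proj_localSplittingCMWith L n hT₀' hT₀'d hJ₀' χ hχ v μ))) (commute_comp_localCenter' hJ₁ ((MpPsi.toRep (localSchrodinger (maximalRealSubfield L) n T₀ v)).comp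
            (scaleTransportSection (maximalRealSubfield L) L (IsCMField.complexConj L) n (complexConj_imagUnit L) (imagUnit_ne_zero L)
              (imagUnit_mul_self L) T₀ T₀' hT₀ hT₀' m₀ hTT₀ hJ₀ hJ₀' v (localSplittingCMWith L n hT₀' hT₀'d hJ₀' χ hχ v μ)
              (proj_localSplittingCMWith L n hT₀' hT₀'d hJ₀' χ hχ v μ)))) g x) =
          rep ξ ((MpPsi.toRep (localSchrodinger (maximalRealSubfield L) n T₀ v)).comp (localSplittingCMWith L n hT₀ hT₀d hJ₀ χ hχ v μ)) (commute_comp_localCenter' hJ₁ ((MpPsi.toRep (localSchrodinger (maximalRealSubfield L) n T₀ v)).comp (localSplittingCMWith L n hT₀ hT₀d hJ₀ χ hχ v μ))) (localCongr L (IsCMField.complexConj L) k (inv_ne_zero ((map_ne_zero _).2 m₀.ne_zero)) hkJ v g) (e x) := by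
  refine Literature.RepresentationTheory.TwistedCoinv.exists_equiv_of_conj ((MpPsi.toRep (localSchrodinger (maximalRealSubfield L) n T₀ v)).comp (localSplittingCMWith L n hT₀ hT₀d hJ₀ χ hχ v μ)) ((MpPsi.toRep (localSchrodinger (maximalRealSubfield L) n T₀ v)).comp
            (scaleTransportSection (maximalRealSubfield L) L (IsCMField.complexConj L) n (complexConj_imagUnit L) (imagUnit_ne_zero L)
              (imagUnit_mul_self L) T₀ T₀' hT₀ hT₀' m₀ hTT₀ hJ₀ hJ₀' v (localSplittingCMWith L n hT₀' hT₀'d hJ₀' χ hχ v μ)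
              (proj_localSplittingCMWith L n hT₀' hT₀'d hJ₀' χ hχ v μ))) (localCenter L (IsCMField.complexConj L) n J₀ J₁ hJ₁ v)
    (fun g => localCongr L (IsCMField.complexConj L) k (inv_ne_zero ((map_ne_zero _).2 m₀.ne_zero)) hkJ v g)
    (fun u => localCongr_localCenter L (IsCMField.complexConj L) k _ hkJ hJ₁ v u) (leviEquivSB (glEquiv (Matrix.GeneralLinearGroup.map (algebraMap (maximalRealSubfield L) (v.adicCompletion (maximalRealSubfield L))) k₀))
            (continuous_linearEquiv' (maximalRealSubfield L) v _) (continuous_linearEquiv' (maximalRealSubfield L) v _)) (fun g w => ?_) ξ _ _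
  -- the conjugation identity of ★ P3u, in the form `ω₁(k g k⁻¹) (L v) = L (ω₂ g v)`
  rw [MonoidHom.comp_apply, MonoidHom.comp_apply,
    toRep_localSplittingCMWith_localCongr_k L v μ n hn t hT₀t hT₀ hT₀d hT₀' hT₀'d m₀ hTT₀ hJ₀ hJ₀' k₀ hk₀ hk hkJ χ hχ m hm g, LinearEquiv.symm_apply_apply]

end CM

end Literature.NumberTheory.GelbartRogawski1991.UnitaryDualPair.LocalSplitting

end
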